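import Summits.BirchSwinnertonDyer.Rank1Residual.GaloisImage.KolyvaginLevelOneUnitCase
import HarnessLib

/-!
# The EXOTIC unit case from KATO-TYPE CLASSES at level one: the dictionary clauses (I4), (Λ),
# (DICT3 at `d = ∅`) on `(E[3], 𝓕̄_can)` with a `3`-unit Kurihara value and `t = 0` give the
# level-one certificate, hence `BSD(E,3)` — predicate-free, class-free, NO tower
# (cell `b2b-bsdres`, team n1011, row T-a5x; the last inch before n1011-p09's R1-21 dictionary; seat p13)

HONEST FRAMING (cell `b2b-bsdres`, run/shared/lean/b2b/bsd-rank1-residual/, verbatim in every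
file): the goal of the cell is to DELETE the COMBINATION-SHAPED residual classes of the
Birch–Swinnerton-Dyer formula for ALL analytic-rank `≤ 1` elliptic curves over `ℚ` — "full BSD
formula for every rank `≤ 1` curve in class `C`" assembled STRICTLY from published theorems — so
that the rank-`≤ 1` remainder becomes exactly the CONSTRUCTION-SHAPED classes, which are TYPED
(missing-input `Prop`s), NOT attempted. This is not "finishing BSD". Team n1011 (N10/N11, the
additive block `X4 ∧ p = 3`): research route; no claim beyond the stated classes; the label X4 and
the mark of RESIDUAL-MAP §I N11 are UNCHANGED by this file; nothing is booked. Theorems only: no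
definition, no named fact is minted.  The end theorem is CONDITIONAL on the three named facts of
`KolyvaginLevelOneUnitCase` (`hS24`, `hS24₂`, `hGZK`), on `hEP`, the Poitou–Tate family, and on the
KATO-TYPE CLASSES hypotheses below (binders), all explicit.  EXOTIC rows are reduced to
(F1)(F2)(F3)(PT)(EP)(Lp) + the certificate; none is closed.

## What and why

`KolyvaginLevelOneUnitCase.bsdp_three_of_levelOne_certificate` (p265535) wants a Kolyvagin system
`κ ∈ KS₁(E[3], 𝓕̄_can, 𝒫(τ))` whose bottom class is NOT a `3`-Selmer class.  In print that class is
KATO's: n1011-p09's R1-21 dictionary `KatoKuriharaDictionaryThreeAt` (p262039; [K22] Thm. 3.13,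
Kato Thm. 12.5, [MR04] Thm. 3.2.4 / App. A) packages, at level `3^{k+1}`, (0) Kato's derivative
classes `κ_d`, (I4) a genuine Kolyvagin system `κ'` congruent to `κ` modulo the classes of strictly
smaller levels, (Λ) the functional `Λ = ι ∘ 3^t·exp*_ω` on `𝓕_can(v₃)` — onto `ℤ/3^{k+1}` with
kernel the Kummer part — and (DICT3) `Λ(loc₃ κ_d) = u·3^t·δ̃_d`.  That predicate is typed in the
`k`-LEVEL spelling (`E[3^k·3]`, `propagatedSelmerStructure W 3 k`); the unit case lives on `E[3]` /
`𝓕̄_can = propagatedSelmerStructureOne W 3`.  This file takes the four clauses AT `m = 1`, `d = ∅`,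
ON `E[3]` as SEPARATE HYPOTHESES (no predicate; whichever E[3]-literal form of the dictionary lands —
a level-one twin of p09's def, or a transport — discharges them by `exact`), and concludes:

* `kolyvaginSystem_apply_empty_eq_of_congruence` — (I4) at `d = ∅`: `κ'_∅ = κ_∅` (no strictly
  smaller level).
* `apply_empty_not_mem_selmerGroup_kummer_of_dictionary` — (Λ)-kernel clause + (DICT3 at `∅`) with
  `u` a unit, `t = 0`, `δ̃_∅ ≠ 0` in `𝔽₃` ⟹ `loc₃ κ_∅ ∉ 𝓚_{v₃}` ⟹ `κ'_∅ ∉ Sel₃` — THE CERTIFICATE.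
* **`bsdp_three_of_katoClasses_levelOne`** — hence `BSD(E, 3)` on `r_an = 0`, `3 ∤ #Ш_an`, surj(3)
  rows, by `bsdp_three_of_levelOne_certificate`.  NO tower, NO (im), NO reduction type.

Binders of the end theorem (nothing hidden): `hS24`, `hS24₂`, `hGZK`; `[Finite E[3]]`; surj(3);
`r_an = 0`; `#Ш_an = q`, `ord₃ q = 0`; the `τ`-datum; the Poitou–Tate family ×4; `hEP`; an admissible
`S`; the Kolyvagin datum `D`, `η`, `hP`, `hT`, `hD` on `E[3]`; a place `v₃ ∣ 3`; AND THE KATO-TYPE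
CLASSES: `κ₀ : levels → H¹(ℚ, E[3])`, `κ' ∈ KS₁(E[3], 𝓕̄_can, 𝒫(τ))` with the (I4) congruence,
`Λ : H¹(ℚ_{v₃}, E[3]) →+ ℤ/3` with the kernel clause on `𝓕̄_can(v₃)`, the value clause
`Λ(loc_{v₃} κ₀ ∅) = u·3^t·δ̃` with `u ∈ (ℤ/3)ˣ`, and the unit data `t = 0`, `δ̃ ≠ 0`.  These five are
EXACTLY [K22] Thm. 3.13's content at `m = 1` for an additive `3` with `3 ∤ c₃` and a `3`-adic unit
`L`-value — NOT in the tree (route R1-21); binders here.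

References: C.-H. Kim, *The structure of Selmer groups and the Iwasawa main conjecture for elliptic
curves* (2022/2025) Thm. 3.13, §3.4 [Kim2022StructureSelmer]; K. Kato, Astérisque 295 (2004) Thm.
12.5 [Kato2004Asterisque]; B. Mazur, K. Rubin, Mem. AMS 799 (2004) Thm. 3.2.4, App. A [MazurRubin2004];
R. Sakamoto, JTNB 36 (2024) Thm. 4.4 [Sakamoto2024].
-/

noncomputable section

open scoped Classical NumberField ContRepresentation
open Field NumberField IsDedekindDomain
open WeierstrassCurve Literature.NumberTheory.EllipticCurves Literature.NumberTheory.GaloisRepresentations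
  Literature.NumberTheory.GaloisRepresentations.DiscreteGaloisModule Literature.NumberTheory.GaloisCohomology

namespace Summit.BirchSwinnertonDyer.Rank1Residual.GaloisImage

variable (W : WeierstrassCurve ℚ) [W.IsElliptic]

/-- **(I4) at the bottom level: `κ'_∅ = κ_∅`.**  If the Kolyvagin system `κ'` is congruent to the
family `κ₀` modulo the classes of STRICTLY smaller levels (the unitriangular bridge of [MR04] App. A /
[K22] §2.2, clause (I4) of n1011-p09's dictionary), then at `d = ∅` — which has no strictly smaller
level — the two bottom classes agree. [folklore] -/
theorem kolyvaginSystem_apply_empty_eq_of_congruence {K : Type} [Field K] [NumberField K]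
    {M : Type} [AddCommGroup M] [TopologicalSpace M] [DiscreteTopology M]
    {ρ : DiscreteGaloisModule K M} {D : KolyvaginDatum ρ} {𝓕 : SelmerStructure ρ}
    (κ₀ : Finset (HeightOneSpectrum (𝓞 K)) → galoisCohomology ρ 1) (κ' : D.kolyvaginSystems 𝓕)
    (hI4 : ∀ d, D.IsLevel d →
      κ'.1 d - κ₀ d ∈ AddSubgroup.closure {x | ∃ c, c ⊂ d ∧ x = κ₀ c}) :
    κ'.1 ∅ = κ₀ ∅ := by
  have h := hI4 ∅ D.isLevel_empty
  have hset : {x : galoisCohomology ρ 1 | ∃ c : Finset (HeightOneSpectrum (𝓞 K)), c ⊂ ∅ ∧ x = κ₀ c}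
      = ∅ := Set.eq_empty_of_forall_notMem fun x ⟨c, hc, _⟩ => Finset.not_ssubset_empty c hc
  rw [hset, AddSubgroup.closure_empty, AddSubgroup.mem_bot, sub_eq_zero] at h
  exact h

omit [W.IsElliptic] in
/-- **The certificate from the dictionary clauses at `m = 1`, `d = ∅`, on `E[3]`.**  Let `v₃ ∣ 3`,
`Λ : H¹(ℚ_{v₃}, E[3]) →+ ℤ/3` with KERNEL CLAUSE "on `𝓕̄_can(v₃)`, `Λ x = 0 ↔ x ∈ 𝓚_{v₃}`"
(the Kummer part), a family `κ₀` and a Kolyvagin system `κ' ∈ KS₁(E[3], 𝓕̄_can, 𝒫)` congruent to it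
(I4), and the VALUE CLAUSE `Λ(loc_{v₃} κ₀ ∅) = u·3^t·δ̃` with `u` a unit.  If `t = 0` and `δ̃ ≠ 0`
(a `3`-adic unit Kurihara/`L`-value and no `3`-torsion in `E(ℚ₃)`), then `κ'_∅` is NOT a `3`-Selmer
class: `loc_{v₃} κ'_∅ = loc_{v₃} κ₀ ∅ ∈ 𝓕̄_can(v₃)` (bottom class of a Kolyvagin system) has
`Λ ≠ 0`, so it is not in the Kummer part.  [cite: Kim2022StructureSelmer, Thm. 3.13 and §3.4.1] -/
theorem apply_empty_not_mem_selmerGroup_kummer_of_dictionary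
    {D : KolyvaginDatum (W.torsionGaloisModule ((3 : ℕ) : ℤ))}
    (v₃ : HeightOneSpectrum (𝓞 ℚ))
    (κ₀ : Finset (HeightOneSpectrum (𝓞 ℚ)) → galoisCohomology (W.torsionGaloisModule ((3 : ℕ) : ℤ)) 1)
    (κ' : D.kolyvaginSystems (propagatedSelmerStructureOne W 3))
    (hI4 : ∀ d, D.IsLevel d →
      κ'.1 d - κ₀ d ∈ AddSubgroup.closure {x | ∃ c, c ⊂ d ∧ x = κ₀ c})
    (Λ : galoisCohomology ((W.torsionGaloisModule ((3 : ℕ) : ℤ)).toLocal (Sum.inr v₃)) 1 →+ ZMod 3)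
    (hΛker : ∀ x ∈ propagatedSelmerStructureOne W 3 (Sum.inr v₃),
      Λ x = 0 ↔ x ∈ W.kummerSelmerStructure ((3 : ℕ) : ℤ) (Sum.inr v₃))
    {u : (ZMod 3)ˣ} {t : ℕ} {δ : ZMod 3}
    (hval : Λ (galoisCohomology.localization _ (Sum.inr v₃) 1 (κ₀ ∅)) =
      (u : ZMod 3) * (3 : ZMod 3) ^ t * δ)
    (ht : t = 0) (hδ : δ ≠ 0) :
    κ'.1 ∅ ∉ (W.kummerSelmerStructure ((3 : ℕ) : ℤ)).selmerGroup := by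
  have heq : κ'.1 ∅ = κ₀ ∅ := kolyvaginSystem_apply_empty_eq_of_congruence κ₀ κ' hI4
  -- the bottom class of a Kolyvagin system lies in `H¹_{𝓕̄_can}`, so its localisation is in `𝓕̄_can(v₃)`
  have hmemF : galoisCohomology.localization _ (Sum.inr v₃) 1 (κ₀ ∅) ∈
      propagatedSelmerStructureOne W 3 (Sum.inr v₃) := by
    rw [← heq]
    exact (SelmerStructure.mem_selmerGroup_iff _ _).1
      ((KolyvaginDatum.mem_kolyvaginSystems_iff D _ κ'.1).mp κ'.2).apply_empty_mem (Sum.inr v₃)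
  -- the value is a unit of `𝔽₃`
  have hne : Λ (galoisCohomology.localization _ (Sum.inr v₃) 1 (κ₀ ∅)) ≠ 0 := by
    rw [hval, ht, pow_zero, mul_one]
    exact mul_ne_zero (Units.ne_zero u) hδ
  intro hsel
  have hloc : galoisCohomology.localization _ (Sum.inr v₃) 1 (κ₀ ∅) ∈
      W.kummerSelmerStructure ((3 : ℕ) : ℤ) (Sum.inr v₃) := by
    rw [← heq]
    exact (SelmerStructure.mem_selmerGroup_iff _ _).1 hsel (Sum.inr v₃)
  exact hne ((hΛker _ hmemF).2 hloc)

/-- **BSD(E, 3) from Kato-type classes at level one — the EXOTIC unit case with the certificate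
UNPACKED into the dictionary clauses.**  For `E/ℚ` with `ρ̄_{E,3}` onto, analytic rank `0`,
`3 ∤ #Ш(E)_an`: given the named facts `hS24`, `hS24₂` ([S24] Thm. 4.4 (1)/(2)), `hGZK`, the
Poitou–Tate family, `hEP`, an admissible `S`, a Kolyvagin datum on `E[3]` for Sakamoto's primes
`𝒫(τ)` (cyclotomic transverse conditions, canonical comparison maps), a place `v₃ ∣ 3`, and
KATO-TYPE CLASSES at level one — a family `κ₀`, a Kolyvagin system
`κ' ∈ KS₁(E[3], 𝓕̄_can, 𝒫(τ))` congruent to it (I4), a functional `Λ : H¹(ℚ_{v₃}, E[3]) → ℤ/3`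
with the Kummer kernel clause on `𝓕̄_can(v₃)` (Λ), and the value clause
`Λ(loc_{v₃} κ₀ ∅) = u·3^t·δ̃` (DICT3 at `∅`) with `t = 0` and `δ̃ ≠ 0` — `BSD(E, 3)` holds
(`apply_empty_not_mem_selmerGroup_kummer_of_dictionary` + p265535
`bsdp_three_of_levelOne_certificate`).  The Kato-type clauses are [K22] Thm. 3.13 at `m = 1` for
an additive `3` (route R1-21, n1011-p09's `KatoKuriharaDictionaryThreeAt` in the level spelling);
they are BINDERS here — nothing about Kato's Euler system is proved in this file.  EXOTIC rows are
reduced to (F1)(F2)(F3)(PT)(EP)(Lp) + the certificate; none is closed.  NO tower, NO (im), NO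
reduction type.  Nothing booked; no mark / label changed.
[cite: Kim2022StructureSelmer, Thm. 3.13] [cite: Sakamoto2024, Thm. 4.4 (p. 926)]
[cite: Miller2011LMS, §1 and Def. 1.1] -/
theorem bsdp_three_of_katoClasses_levelOne
    (hS24 : Sakamoto2024.kolyvaginSystems_freeRankOne_zmod_three_pow)
    (hS24₂ : Sakamoto2024.kolyvaginSystems_idealOfBasis_eq_fittingIdeal_zmod_three_pow)
    (hGZK : rank_eq_analyticRank_of_analyticRank_le_one)
    [Finite (geomTorsion W ((3 : ℕ) : ℤ))]
    (h3 : W.HasSurjectiveModNGaloisRep ((3 : ℕ) : ℤ)) (hr : W.analyticRank = 0)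
    {q : ℚ} (hq : shaAn W = (q : ℂ)) (hv : padicValRat 3 q = 0)
    (τ : absoluteGaloisGroup ℚ) (hτμ : τ ∈ rootsOfUnityFixer ℚ 3)
    (hτq : Nonempty (cokerSubOne (W.torsionGaloisModule ((3 : ℕ) : ℤ)) τ ≃+ ZMod 3))
    (inv : LocalInvariants ℚ 3) (hperf : inv.IsPerfect) (hsum : inv.SumLocalTermEqZero)
    (hunro : inv.UnramifiedOrthogonal) (hcompl : inv.SelmerComplement)
    (hEP : ∀ v : HeightOneSpectrum (𝓞 ℚ), localEulerPoincareCharacteristic (v.adicCompletion ℚ))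
    (S : Finset (Place ℚ)) (hS : ∀ w : InfinitePlace ℚ, (Sum.inl w : Place ℚ) ∈ S)
    (h3S : ∀ v : HeightOneSpectrum (𝓞 ℚ), ((3 : ℕ) : 𝓞 ℚ) ∈ v.asIdeal → (Sum.inr v : Place ℚ) ∈ S)
    (hbadS : ∀ v : HeightOneSpectrum (𝓞 ℚ), ¬ W.HasGoodReductionAt v → (Sum.inr v : Place ℚ) ∈ S)
    (D : KolyvaginDatum (W.torsionGaloisModule ((3 : ℕ) : ℤ)))
    (η : (q : HeightOneSpectrum (𝓞 ℚ)) → (ZMod (Ideal.absNorm q.asIdeal))ˣ)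
    (hP : D.primes = frobeniusClassPrimes (W.torsionGaloisModule ((3 : ℕ) : ℤ))
      {v | (Sum.inr v : Place ℚ) ∈ S} τ 3)
    (hT : D.transverse = cyclotomicTransverse (W.torsionGaloisModule ((3 : ℕ) : ℤ)))
    (hD : D.HasCanonicalComparison 3 η)
    -- the Kato-type classes at level one (route R1-21's dictionary at `m = 1`, on `E[3]`)
    (v₃ : HeightOneSpectrum (𝓞 ℚ))
    (κ₀ : Finset (HeightOneSpectrum (𝓞 ℚ)) → galoisCohomology (W.torsionGaloisModule ((3 : ℕ) : ℤ)) 1)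
    (κ' : D.kolyvaginSystems (propagatedSelmerStructureOne W 3))
    (hI4 : ∀ d, D.IsLevel d →
      κ'.1 d - κ₀ d ∈ AddSubgroup.closure {x | ∃ c, c ⊂ d ∧ x = κ₀ c})
    (Λ : galoisCohomology ((W.torsionGaloisModule ((3 : ℕ) : ℤ)).toLocal (Sum.inr v₃)) 1 →+ ZMod 3)
    (hΛker : ∀ x ∈ propagatedSelmerStructureOne W 3 (Sum.inr v₃),
      Λ x = 0 ↔ x ∈ W.kummerSelmerStructure ((3 : ℕ) : ℤ) (Sum.inr v₃))
    {u : (ZMod 3)ˣ} {t : ℕ} {δ : ZMod 3}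
    (hval : Λ (galoisCohomology.localization _ (Sum.inr v₃) 1 (κ₀ ∅)) =
      (u : ZMod 3) * (3 : ZMod 3) ^ t * δ)
    (ht : t = 0) (hδ : δ ≠ 0) :
    BSDp W 3 :=
  bsdp_three_of_levelOne_certificate W hS24 hS24₂ hGZK h3 hr hq hv τ hτμ hτq inv hperf hsum hunro hcompl
    hEP S hS h3S hbadS D η hP hT hD κ'
    (apply_empty_not_mem_selmerGroup_kummer_of_dictionary W v₃ κ₀ κ' hI4 Λ hΛker hval ht hδ)

end Summit.BirchSwinnertonDyer.Rank1Residual.GaloisImage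

end
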